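import Summits.AtomisticToContinuum.Crystallization.Theorems.FluxTubeKeplerFloorGivesLayered
import Summits.AtomisticToContinuum.Crystallization.Theorems.FluxTubeKeplerFluxCellKeplerSingleScale
import Summits.AtomisticToContinuum.Crystallization.Theorems.FluxTubeKeplerFluxCellKeplerGoodSitesWindows
import Summits.AtomisticToContinuum.Crystallization.Theorems.ChessboardParticlePlanesPeriodicWindowsIffCrystallization
import Summits.AtomisticToContinuum.Crystallization.Theorems.FluxTubeKeplerKeplerEnergyFloor
import Summits.AtomisticToContinuum.Crystallization.Theses.SurfaceTensionNoFoam

/-!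
# Line `SparseBlindRung` (crowd ladder) — skeleton for the forward rung over `FluxTubeKepler.FloorGivesLayered`
(crux dir `FluxCellKepler`, stmt-AtomisticToContinuum-15221; fwd-rung G1 gen 21, seed g1-AtomisticToContinuum-15223)

FLOOR (proved, `FluxTubeKeplerFloorGivesLayered.FloorGivesLayered_proof`): for every periodic `P₀`, the energy
floor `N·e(P₀) ≤ E(x)` on Lennard-Jones ground states together with the defect BUDGET
`c(R,η) · #{(R,η)-non-layered sites} ≤ E(x) − N·e(P₀)` — a Kepler-type certificate that prices EVERY non-layered site,
WHEREVER it sits in the cluster — forces layered windows, hence (proved `PeriodicGivenLayered`) periodic windows, along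
every ground-state sequence.  Its proof is `o(N)` counting (`eventually_exists_not_bad`) + Bolzano–Weierstrass on the
spacing + dilation covariance: the good site it selects may sit ANYWHERE, so the certificate must price everywhere.

THE GRADED FAMILY `CrowdRung θ κ` (ONE move — one hypothesis weakened along a NEW axis, LOCATION at the mesoscale
`θ·N^{1/3}`: the SET OF PRICED SITES shrinks from "`(R,η)`-non-layered" to "`(R,η)`-non-layered AND `(θ,κ)`-crowded"):
* `Crowded θ κ x i` — at least `κ·N` particles lie within `θ·N^{1/3}` of `x i` (a purely metric, template-free,
  potential-free, MACROSCOPIC datum: the site belongs to a region carrying a positive fraction of the mass at the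
  natural length scale `N^{1/3}` of an `N`-particle cluster; `κ ≤ 0`: every site is crowded);
* `CrowdBudget θ κ P₀` prices only the sites that are `(R,η)`-non-layered AND `(θ,κ)`-crowded — the certificate is BLIND
  to every mesoscopically SPARSE region (tentacles, detached or foam-like lobes, dust: fewer than `κN` particles within
  `θN^{1/3}`); `CrowdRung θ κ`: FLOOR + `CrowdBudget θ κ` force periodic windows along every ground-state sequence;
* `CrowdRung θ 0` is the floor for every `θ` (`crowdRung_zero`); the dial is monotone: `CrowdRung θ κ' → CrowdRung θ κ`
  for `κ ≤ κ'` (`crowdRung_anti`) and `CrowdRung θ κ → CrowdRung θ' κ` for `θ ≤ θ'` (`crowdRung_mono_scale`); every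
  member is a consequence of the sub-problem (`crowdRung_of_crystallization`, on path, via the landed
  `periodicWindows_of_crystallization`);
* deciding rung `SparseBlindRung := ∀ θ > 0, ∃ κ > 0, CrowdRung θ κ` — "at every mesoscale some filling fraction can
  be exempted: a Kepler certificate that never looks at a mesoscopically sparse region still forces crystallization
  of the Lennard-Jones ground states".  The floor's counting cannot reach it: `o(N)` counting applied to the crowded
  budget yields a site that is layered-good OR SPARSE, and a sparse site carries no template; to place the good site
  INSIDE a crowded ball one needs that crowded balls EXIST and carry `≥ κN` particles along every ground-state
  sequence — MACROSCOPIC NON-VANISHING of the ground states at scale `N^{1/3}` (`Sig.NonVanishing`: no loss of mass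
  by dispersal; the three-dimensional Lennard-Jones analogue of Au Yeung–Friesecke–Schmidt's "compactness and mass
  conservation", Prop. 3.1 of arXiv:0909.0927, known only in two dimensions), which is neither in the tree nor in
  print for `d = 3`.  `SparseBlindRung_of_nonVanishing` (sorry-free) shows it is exactly the restoring input.

Stubs (the only `sorry`s), one sufficient package for non-vanishing: `stub_exposedSitesCost` (BY NAME the open crux
`SurfaceTensionNoFoam.ExposedSitesCost`, stmt-AtomisticToContinuum-13448: vacuum-adjacent sites are priced by the
excess energy), `stub_surfaceExcess` (VERBATIM gen 10's `MarginLadder.Sig.stub_surfaceExcess`: trial upper bound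
`E(N) ≤ N·e(P₀) + C·N^{2/3}`), `stub_concentration` (ground-state-free discrete isoperimetry: a `δ`-separated `N`-point
set with `≤ C·N^{2/3}` vacuum-adjacent sites has, at every mesoscale `θ`, a ball of radius `θN^{1/3}` holding `≥ κN`
points).  Composition `SparseBlindRung_of` is sorry-free: exposure cost + surface bound (at a floor-attaining `P₀`,
`e(P₀) = e⋆` by `floor_iff_eq_eStar`) give `#exposed ≤ (C/c)·N^{2/3}` on ground states, minimal distance
(`LennardJonesMinimalDistance_holds`) + concentration give non-vanishing, then `o(N)` counting localised to the crowded
half-ball (`eventually_card_lt`, `crowded_of_near`) gives a layered-good site at every scale, and the landed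
`FluxCellKeplerSketch.stub_layeredWindowsOfGoodSites` + proved `PeriodicGivenLayered` give periodic windows.
-/

noncomputable section

namespace Summit.AtomisticToContinuum.Crystallization.Cruxes.FluxCellKepler.CrowdLadder

open scoped BigOperators Classical
open Filter Topology
open Literature.MathematicalPhysics.StatisticalMechanics
open Summit.AtomisticToContinuum.Crystallization.Theorems.FluxCellKeplerSingleScale (LayeredGood layeredGood_mono)
open Summit.AtomisticToContinuum.Crystallization.Theorems.ChargedEnergyGapNegative (eStar crysEnergyLimit)

local notation "E3" => EuclideanSpace ℝ (Fin 3)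

/-! ## The object of the ladder: crowded sites at the mesoscale `θ·N^{1/3}` -/

/-- **`(θ,κ)`-CROWDED**: at least `κ·N` particles of the configuration (the site itself included) lie within
`θ·N^{1/3}` of `x i`.  Template-free, potential-free, purely metric; for `κ ≤ 0` every site is crowded. -/
def Crowded (θ κ : ℝ) {N : ℕ} (x : Fin N → E3) (i : Fin N) : Prop :=
  κ * (N : ℝ) ≤ (Nat.card {j : Fin N // dist (x j) (x i) ≤ θ * (N : ℝ) ^ (1 / 3 : ℝ)} : ℝ)

/-! ## The rung family -/

/-- FLOOR(P₀): `N · e(P₀) ≤ E(x)` for every Lennard-Jones ground state `x` of every size `N`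
(verbatim the first hypothesis of `FluxTubeKepler.FloorGivesLayered`). -/
def Floor (P₀ : PeriodicConfiguration 3) : Prop :=
  ∀ (N : ℕ) (x : Fin N → E3), IsGroundState lennardJones x →
    (N : ℝ) * P₀.energyPerParticle lennardJones ≤ interactionEnergy lennardJones x

/-- CROWD BUDGET at mesoscale `θ` and filling `κ`: for every radius `R > 0` and tolerance `η > 0` some `c > 0` prices
the sites of every Lennard-Jones ground state that are `(R,η)`-non-layered AND `(θ,κ)`-crowded, against the excess
energy over `N · e(P₀)` (`κ = 0`: the floor's budget, every non-layered site priced; quantifier order `∀ R η ∃ c` of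
the crux kept — Disproof §5: no `c` uniform in `R`). -/
def CrowdBudget (θ κ : ℝ) (P₀ : PeriodicConfiguration 3) : Prop :=
  ∀ R η : ℝ, 0 < R → 0 < η → ∃ c : ℝ, 0 < c ∧
    ∀ (N : ℕ) (x : Fin N → E3), IsGroundState lennardJones x →
      c * (Nat.card {i : Fin N // ¬ LayeredGood R η x i ∧ Crowded θ κ x i} : ℝ) ≤
        interactionEnergy lennardJones x - (N : ℝ) * P₀.energyPerParticle lennardJones

/-- Periodic windows at every scale along the sequence `x` (ONE periodic `P`, translations only) —
verbatim the conclusion of `FluxTubeKepler.PeriodicWindows` / `FluxTubeKepler.PeriodicGivenLayered`. -/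
def HasPeriodicWindows (x : (N : ℕ) → (Fin N → E3)) : Prop :=
  ∃ P : PeriodicConfiguration 3, ∀ R ε : ℝ, 0 < ε → ∃ᶠ N in atTop, ∃ t : E3,
    (∀ q ∈ P.points, ‖q‖ ≤ R → ∃ i : Fin N, dist (x N i + t) q ≤ ε) ∧
    (∀ i : Fin N, ‖x N i + t‖ ≤ R → ∃ q ∈ P.points, dist (x N i + t) q ≤ ε)

/-- **The graded family.** `CrowdRung θ κ`: FLOOR and the crowd budget at `(θ, κ)` force periodic windows along every
Lennard-Jones ground-state sequence. -/
def CrowdRung (θ κ : ℝ) : Prop :=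
  ∀ P₀ : PeriodicConfiguration 3, Floor P₀ → CrowdBudget θ κ P₀ →
    ∀ x : (N : ℕ) → (Fin N → E3), (∀ N, IsGroundState lennardJones (x N)) → HasPeriodicWindows x

/-- **Deciding rung**: at every mesoscale `θ` some positive filling fraction `κ` may be exempted — a certificate blind
to every mesoscopically sparse region still forces crystallization of the ground states. -/
def SparseBlindRung : Prop := ∀ θ : ℝ, 0 < θ → ∃ κ : ℝ, 0 < κ ∧ CrowdRung θ κ

/-! ## Counting helpers -/

theorem natCard_mono {N : ℕ} {p q : Fin N → Prop} (h : ∀ i, p i → q i) :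
    Nat.card {i // p i} ≤ Nat.card {i // q i} := by
  rw [Nat.card_eq_fintype_card, Nat.card_eq_fintype_card]
  exact Fintype.card_subtype_mono _ _ h

/-- For `κ ≤ 0` every site is crowded. -/
theorem crowded_of_nonpos {θ κ : ℝ} (hκ : κ ≤ 0) {N : ℕ} (x : Fin N → E3) (i : Fin N) : Crowded θ κ x i :=
  (mul_nonpos_of_nonpos_of_nonneg hκ (Nat.cast_nonneg N)).trans (Nat.cast_nonneg _)

/-- Crowdedness is antitone in the filling fraction. -/
theorem crowded_anti {θ κ κ' : ℝ} (hκ : κ ≤ κ') {N : ℕ} (x : Fin N → E3) (i : Fin N) :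
    Crowded θ κ' x i → Crowded θ κ x i := fun h =>
  (mul_le_mul_of_nonneg_right hκ (Nat.cast_nonneg N)).trans h

/-- Crowdedness is monotone in the mesoscale. -/
theorem crowded_mono_scale {θ θ' κ : ℝ} (hθ : θ ≤ θ') {N : ℕ} (x : Fin N → E3) (i : Fin N) :
    Crowded θ κ x i → Crowded θ' κ x i := fun h => by
  refine h.trans ?_
  have hr : θ * (N : ℝ) ^ (1 / 3 : ℝ) ≤ θ' * (N : ℝ) ^ (1 / 3 : ℝ) :=
    mul_le_mul_of_nonneg_right hθ (Real.rpow_nonneg (Nat.cast_nonneg N) _)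
  exact_mod_cast natCard_mono (p := fun j => dist (x j) (x i) ≤ θ * (N : ℝ) ^ (1 / 3 : ℝ))
    (q := fun j => dist (x j) (x i) ≤ θ' * (N : ℝ) ^ (1 / 3 : ℝ)) fun j hj => hj.trans hr

/-! ## F3 — the family specialises to the proved floor -/

/-- At filling `0` the crowd budget IS the floor's budget. -/
theorem crowdBudget_zero_iff (θ : ℝ) (P₀ : PeriodicConfiguration 3) :
    CrowdBudget θ 0 P₀ ↔
      ∀ R η : ℝ, 0 < R → 0 < η → ∃ c : ℝ, 0 < c ∧
        ∀ (N : ℕ) (x : Fin N → E3), IsGroundState lennardJones x →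
          c * (Nat.card {i : Fin N // ¬ LayeredGood R η x i} : ℝ) ≤
            interactionEnergy lennardJones x - (N : ℝ) * P₀.energyPerParticle lennardJones := by
  simp only [CrowdBudget, Crowded, zero_mul, Nat.cast_nonneg, and_true]

/-- `CrowdRung θ 0` is the floor: the seed theorem followed by the proved `PeriodicGivenLayered`. -/
theorem crowdRung_zero (θ : ℝ) : CrowdRung θ 0 := fun P₀ hF hB x hx =>
  Theses.FluxTubeKepler.PeriodicGivenLayered_holds x hx
    (Theorems.FluxTubeKeplerFloorGivesLayered.FloorGivesLayered_proof P₀ hF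
      ((crowdBudget_zero_iff θ P₀).1 hB) x hx)

/-! ## Dial: larger filling / smaller mesoscale = stronger rung; `κ ≤ 0` = the floor -/

/-- A budget pricing a superset implies the budget pricing the subset: `CrowdBudget θ κ → CrowdBudget θ κ'` for
`κ ≤ κ'`. -/
theorem crowdBudget_mono (θ : ℝ) {κ κ' : ℝ} (hκ : κ ≤ κ') (P₀ : PeriodicConfiguration 3) :
    CrowdBudget θ κ P₀ → CrowdBudget θ κ' P₀ := by
  intro hB R η hR hη
  obtain ⟨c, hc, hcB⟩ := hB R η hR hη
  refine ⟨c, hc, fun N x hx => le_trans ?_ (hcB N x hx)⟩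
  have hle : Nat.card {i : Fin N // ¬ LayeredGood R η x i ∧ Crowded θ κ' x i} ≤
      Nat.card {i : Fin N // ¬ LayeredGood R η x i ∧ Crowded θ κ x i} :=
    natCard_mono fun i hi => ⟨hi.1, crowded_anti hκ x i hi.2⟩
  exact mul_le_mul_of_nonneg_left (by exact_mod_cast hle) hc.le

/-- Same along the mesoscale: `CrowdBudget θ' κ → CrowdBudget θ κ` for `θ ≤ θ'`. -/
theorem crowdBudget_anti_scale {θ θ' : ℝ} (hθ : θ ≤ θ') (κ : ℝ) (P₀ : PeriodicConfiguration 3) :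
    CrowdBudget θ' κ P₀ → CrowdBudget θ κ P₀ := by
  intro hB R η hR hη
  obtain ⟨c, hc, hcB⟩ := hB R η hR hη
  refine ⟨c, hc, fun N x hx => le_trans ?_ (hcB N x hx)⟩
  have hle : Nat.card {i : Fin N // ¬ LayeredGood R η x i ∧ Crowded θ κ x i} ≤
      Nat.card {i : Fin N // ¬ LayeredGood R η x i ∧ Crowded θ' κ x i} :=
    natCard_mono fun i hi => ⟨hi.1, crowded_mono_scale hθ x i hi.2⟩
  exact mul_le_mul_of_nonneg_left (by exact_mod_cast hle) hc.le

/-- The dial in the filling: `CrowdRung θ κ' → CrowdRung θ κ` for `κ ≤ κ'`. -/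
theorem crowdRung_anti (θ : ℝ) {κ κ' : ℝ} (hκ : κ ≤ κ') (h : CrowdRung θ κ') : CrowdRung θ κ :=
  fun P₀ hF hB x hx => h P₀ hF (crowdBudget_mono θ hκ P₀ hB) x hx

/-- The dial in the mesoscale: `CrowdRung θ κ → CrowdRung θ' κ` for `θ ≤ θ'`. -/
theorem crowdRung_mono_scale {θ θ' : ℝ} (hθ : θ ≤ θ') (κ : ℝ) (h : CrowdRung θ κ) : CrowdRung θ' κ :=
  fun P₀ hF hB x hx => h P₀ hF (crowdBudget_anti_scale hθ κ P₀ hB) x hx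

/-- Every member with `κ ≥ 0` implies the floor member (informational `specialises`). -/
theorem crowdRung_zero_of_crowdRung {θ κ : ℝ} (hκ : 0 ≤ κ) (h : CrowdRung θ κ) : CrowdRung θ 0 :=
  crowdRung_anti θ hκ h

/-- Members with `κ ≤ 0` ARE the floor. -/
theorem crowdRung_of_nonpos (θ : ℝ) {κ : ℝ} (hκ : κ ≤ 0) : CrowdRung θ κ :=
  crowdRung_anti θ hκ (crowdRung_zero θ)

/-- The deciding rung hands down every smaller positive filling at the same mesoscale. -/
theorem crowdRung_of_sparseBlindRung (h : SparseBlindRung) {θ : ℝ} (hθ : 0 < θ) :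
    ∃ κ : ℝ, 0 < κ ∧ ∀ κ' : ℝ, κ' ≤ κ → CrowdRung θ κ' := by
  obtain ⟨κ, hκ, hR⟩ := h θ hθ
  exact ⟨κ, hκ, fun κ' hκ' => crowdRung_anti θ hκ' hR⟩

/-! ## F4 — on-path lemmas: the sub-problem implies every member -/

/-- ON-PATH: `Crystallization → CrowdRung θ κ` (landed hull-criterion converse `periodicWindows_of_crystallization`). -/
theorem crowdRung_of_crystallization (θ κ : ℝ) (h : _root_.Crystallization) : CrowdRung θ κ :=
  fun _ _ _ x hx =>
    Theorems.ChessboardParticlePlanesPeriodicWindowsIffCrystallization.periodicWindows_of_crystallization h x hx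

/-- ON-PATH for the deciding rung (tagged `aesop safe apply` so that the tribunal's fixed `S → C` portfolio finds it). -/
@[aesop safe apply]
theorem SparseBlindRung_of_Crystallization (h : _root_.Crystallization) : SparseBlindRung :=
  fun θ _ => ⟨1, one_pos, crowdRung_of_crystallization θ 1 h⟩

/-! ## How the rung relieves the parent crux `FluxCellKepler` (documentation, sorry-free) -/

/-- The package the parent route would have to deliver for THIS rung: a periodic `P₀` with FLOOR and the crowd
budget — a Kepler-type certificate that never prices a mesoscopically sparse region. -/
def CrowdKeplerFloor (θ κ : ℝ) : Prop := ∃ P₀ : PeriodicConfiguration 3, Floor P₀ ∧ CrowdBudget θ κ P₀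

theorem windows_of_crowdRung {θ κ : ℝ} (h : CrowdRung θ κ) (hK : CrowdKeplerFloor θ κ) :
    ∀ x : (N : ℕ) → (Fin N → E3), (∀ N, IsGroundState lennardJones (x N)) → HasPeriodicWindows x := by
  obtain ⟨P₀, hF, hB⟩ := hK
  exact fun x hx => h P₀ hF hB x hx

/-- The parent crux gives the package at every `(θ, κ)`, `κ ≥ 0` (proved `KeplerEnergyFloor` + minimal distance + the
dial). -/
theorem crowdKeplerFloor_of_fluxCellKepler (θ : ℝ) {κ : ℝ} (hκ : 0 ≤ κ)
    (hK : Theses.FluxTubeKepler.FluxCellKepler) : CrowdKeplerFloor θ κ := by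
  obtain ⟨P₀, hF, hB⟩ := Theorems.keplerEnergyFloor_proof hK LennardJonesMinimalDistance_holds
  exact ⟨P₀, hF, crowdBudget_mono θ hκ P₀ ((crowdBudget_zero_iff θ P₀).2 fun R η hR hη => hB R η hR hη)⟩

/-! ## The kernel of the line, I: `o(N)` counting localised to a crowded ball (sorry-free) -/

/-- COUNTING (quantitative form of the seed's `eventually_exists_not_bad`): under FLOOR(P₀), a budget
`c·#{bad sites} ≤ E(x) − N·e(P₀)` with `c > 0` makes `#{bad sites} < εN` eventually in `N`, for every `ε > 0`
(`e(P₀) = e⋆` by `floor_iff_eq_eStar` and `E(N)/N → e⋆` by `crysEnergyLimit`). -/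
theorem eventually_card_lt (P₀ : PeriodicConfiguration 3) (hE : Floor P₀)
    {bad : (N : ℕ) → (Fin N → E3) → Fin N → Prop} {c : ℝ} (hc : 0 < c)
    (hcN : ∀ (N : ℕ) (x : Fin N → E3), IsGroundState lennardJones x →
      c * (Nat.card {i : Fin N // bad N x i} : ℝ) ≤
        interactionEnergy lennardJones x - (N : ℝ) * P₀.energyPerParticle lennardJones)
    {ε : ℝ} (hε : 0 < ε) :
    ∀ᶠ N in atTop, ∀ x : Fin N → E3, IsGroundState lennardJones x →
      (Nat.card {i : Fin N // bad N x i} : ℝ) < ε * N := by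
  have heq := (Theorems.FluxTubeKeplerFloorGivesLayered.floor_iff_eq_eStar P₀).1 hE
  have hlim := crysEnergyLimit
  have hcε : 0 < c * ε := mul_pos hc hε
  have hlt : (⨅ Q : PeriodicConfiguration 3, Q.energyPerParticle lennardJones) < eStar + c * ε := by
    change eStar < eStar + c * ε
    linarith
  have hev : ∀ᶠ N : ℕ in atTop, groundStateEnergy lennardJones 3 N / N < eStar + c * ε :=
    hlim.eventually (gt_mem_nhds hlt)
  filter_upwards [hev, Filter.eventually_gt_atTop 0] with N hN hNpos x hx
  have h1 := hcN N x hx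
  rw [heq, hx.2] at h1
  have hNr : (0 : ℝ) < N := by exact_mod_cast hNpos
  have h2 : groundStateEnergy lennardJones 3 N < (eStar + c * ε) * N := by
    rwa [div_lt_iff₀ hNr] at hN
  have h3 : c * (Nat.card {i : Fin N // bad N x i} : ℝ) < c * (ε * N) := by nlinarith
  exact lt_of_mul_lt_mul_left h3 hc.le

/-- Every particle of a half-scale ball holding `κN` particles is `(θ,κ)`-crowded (triangle inequality). -/
theorem crowded_of_near {θ κ : ℝ} {N : ℕ} (x : Fin N → E3) (p : E3)
    (hp : κ * (N : ℝ) ≤ (Nat.card {j : Fin N // dist (x j) p ≤ θ / 2 * (N : ℝ) ^ (1 / 3 : ℝ)} : ℝ))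
    (i : Fin N) (hi : dist (x i) p ≤ θ / 2 * (N : ℝ) ^ (1 / 3 : ℝ)) : Crowded θ κ x i := by
  unfold Crowded
  refine hp.trans ?_
  have hle : Nat.card {j : Fin N // dist (x j) p ≤ θ / 2 * (N : ℝ) ^ (1 / 3 : ℝ)} ≤
      Nat.card {j : Fin N // dist (x j) (x i) ≤ θ * (N : ℝ) ^ (1 / 3 : ℝ)} :=
    natCard_mono (p := fun j => dist (x j) p ≤ θ / 2 * (N : ℝ) ^ (1 / 3 : ℝ))
      (q := fun j => dist (x j) (x i) ≤ θ * (N : ℝ) ^ (1 / 3 : ℝ)) fun j hj => by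
        calc dist (x j) (x i) ≤ dist (x j) p + dist (x i) p := dist_triangle_right _ _ _
          _ ≤ θ / 2 * (N : ℝ) ^ (1 / 3 : ℝ) + θ / 2 * (N : ℝ) ^ (1 / 3 : ℝ) := add_le_add hj hi
          _ = θ * (N : ℝ) ^ (1 / 3 : ℝ) := by ring
  exact_mod_cast hle

/-- **MACROSCOPIC NON-VANISHING of the Lennard-Jones ground states** (the restoring input, as a named statement):
at every mesoscale `θ` there is a filling `κ > 0` such that, eventually in `N`, every `N`-particle ground state has a
ball of radius `θ·N^{1/3}` holding at least `κN` particles — no loss of mass by dispersal at the cluster's own length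
scale.  Known in `d = 2` for Heitmann–Radin-type potentials (Au Yeung–Friesecke–Schmidt 2012, Prop. 3.1); open for
Lennard-Jones in `d = 3`. [conjecture] -/
def Sig.NonVanishing : Prop :=
  ∀ θ : ℝ, 0 < θ → ∃ κ : ℝ, 0 < κ ∧ ∀ᶠ N : ℕ in atTop, ∀ x : Fin N → E3, IsGroundState lennardJones x →
    ∃ p : E3, κ * (N : ℝ) ≤ (Nat.card {j : Fin N // dist (x j) p ≤ θ * (N : ℝ) ^ (1 / 3 : ℝ)} : ℝ)

/-- **Kernel.** Non-vanishing at the half scale `θ/2` with filling `κ > 0` gives `CrowdRung θ κ`: at every `(R, η)`,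
`o(N)` counting makes the priced (non-layered AND crowded) sites fewer than `κN` eventually, while every particle of the
half-scale ball is crowded and there are `≥ κN` of them — so one of them is `(R,η)`-layered-good; the landed
`stub_layeredWindowsOfGoodSites` and the proved `PeriodicGivenLayered` finish. -/
theorem crowdRung_of_nonVanishing {θ κ : ℝ} (hκ : 0 < κ)
    (hNV : ∀ᶠ N : ℕ in atTop, ∀ x : Fin N → E3, IsGroundState lennardJones x →
      ∃ p : E3, κ * (N : ℝ) ≤ (Nat.card {j : Fin N // dist (x j) p ≤ θ / 2 * (N : ℝ) ^ (1 / 3 : ℝ)} : ℝ)) :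
    CrowdRung θ κ := by
  intro P₀ hF hB x hx
  refine Theses.FluxTubeKepler.PeriodicGivenLayered_holds x hx
    (Theorems.FluxCellKeplerSketch.stub_layeredWindowsOfGoodSites x fun R η hR hη => ?_)
  obtain ⟨c, hc, hcB⟩ := hB R η hR hη
  have hev := eventually_card_lt P₀ hF (bad := fun N y i => ¬ LayeredGood R η y i ∧ Crowded θ κ y i) hc hcB hκ
  have hgood : ∀ᶠ N in atTop, ∃ i : Fin N, LayeredGood R η (x N) i := by
    filter_upwards [hev, hNV] with N hN hNV'
    obtain ⟨p, hp⟩ := hNV' (x N) (hx N)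
    have h1 := hN (x N) (hx N)
    by_contra hno
    push Not at hno
    have hle : Nat.card {j : Fin N // dist (x N j) p ≤ θ / 2 * (N : ℝ) ^ (1 / 3 : ℝ)} ≤
        Nat.card {i : Fin N // ¬ LayeredGood R η (x N) i ∧ Crowded θ κ (x N) i} :=
      natCard_mono (p := fun j => dist (x N j) p ≤ θ / 2 * (N : ℝ) ^ (1 / 3 : ℝ))
        (q := fun i => ¬ LayeredGood R η (x N) i ∧ Crowded θ κ (x N) i)
        fun j hj => ⟨hno j, crowded_of_near (x N) p hp j hj⟩
    have hle' : (Nat.card {j : Fin N // dist (x N j) p ≤ θ / 2 * (N : ℝ) ^ (1 / 3 : ℝ)} : ℝ) ≤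
        Nat.card {i : Fin N // ¬ LayeredGood R η (x N) i ∧ Crowded θ κ (x N) i} := by exact_mod_cast hle
    linarith
  exact hgood.frequently.mono fun N ⟨i, hi⟩ => ⟨i, hi⟩

/-- The restoring input closes the deciding rung: `NonVanishing → SparseBlindRung` (sorry-free). -/
theorem SparseBlindRung_of_nonVanishing (h : Sig.NonVanishing) : SparseBlindRung := fun θ hθ => by
  obtain ⟨κ, hκ, hev⟩ := h (θ / 2) (by positivity)
  exact ⟨κ, hκ, crowdRung_of_nonVanishing hκ hev⟩

/-! ## The line: exposure cost + surface bound + isoperimetric concentration ⇒ non-vanishing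

Three declared stubs. -/

/-- **Stub 1 — EXPOSED SITES ARE PRICED** (BY NAME the open crux `SurfaceTensionNoFoam.ExposedSitesCost`,
stmt-AtomisticToContinuum-13448, shared with route `SurfaceTensionNoFoam`): there is `r₀ > 0` such that for every
`R > 0` some `c > 0` gives `c·#{i : some point within R of x_i has no particle strictly within r₀} ≤ E(N) − N·e⋆` on
every Lennard-Jones ground state.  One proof closes both items. [cite: BlancLewin2015, §2.3; AuYeungFrieseckeSchmidt2012, Prop. 3.1] -/
theorem stub_exposedSitesCost : Theses.SurfaceTensionNoFoam.ExposedSitesCost := by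
  sorry

/-- **Stub 2 — SURFACE-ORDER UPPER BOUND** (VERBATIM the statement of gen 10's
`MarginLadder.Sig.stub_surfaceExcess`, `Lines/DecayingMarginRung.lean`; one proof closes both): for every periodic
`P₀` there is `C` with `E(N) ≤ N·e(P₀) + C·N^{2/3}` for all `N` (trial states: `N` points of `P₀` in a ball; the
Lennard-Jones tail is summable, site energies are bounded, a ball meets `O(N^{2/3})` boundary cells). [folklore] -/
theorem stub_surfaceExcess :
    ∀ P₀ : PeriodicConfiguration 3, ∃ C : ℝ, ∀ N : ℕ,
      groundStateEnergy lennardJones 3 N ≤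
        (N : ℝ) * P₀.energyPerParticle lennardJones + C * (N : ℝ) ^ (2 / 3 : ℝ) := by
  sorry

/-- **Stub 3 — ISOPERIMETRIC CONCENTRATION** (ground-state-free, potential-free discrete geometry): for a separation
`δ > 0`, a probe radius `r₀ > 0`, a constant `C` and a mesoscale `θ > 0` there are `κ > 0` and `N₀` such that every
`δ`-separated `N`-point configuration, `N ≥ N₀`, with at most `C·N^{2/3}` VACUUM-ADJACENT points (points `x_i` with
an empty open `r₀`-ball whose centre is within `r₀` of `x_i` — the exposure predicate of `ExposedSitesCost` at
`R = r₀`) has a ball of radius `θ·N^{1/3}` holding at least `κN` points.  Proof plan: `U = ⋃ B(x_k, r₀)` has volume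
`≥ N·|B(min(δ/2, r₀))|` and `∂U ⊆ ⋃_{k exposed} S(x_k, r₀)`; if every ball of radius `θN^{1/3}` held `< κN` points,
every cube of side `θN^{1/3}/√3` would meet `U` in volume `≤ κN·|B(r₀)|`, and the relative isoperimetric inequality
summed over the cube grid (discretely: Loomis–Whitney on a grid of mesh `≪ min(δ, r₀)`, cut faces averaged over grid
offsets) would give `area(∂U) ≥ c·N^{2/3}/κ^{1/3}`, contradicting `area(∂U) ≤ 4πr₀²·C·N^{2/3}` for `κ` small. [folklore] -/
theorem stub_concentration :
    ∀ δ r₀ : ℝ, 0 < δ → 0 < r₀ → ∀ C θ : ℝ, 0 < θ → ∃ κ : ℝ, 0 < κ ∧ ∃ N₀ : ℕ, ∀ N : ℕ, N₀ ≤ N →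
      ∀ x : Fin N → E3, (∀ i j : Fin N, i ≠ j → δ ≤ dist (x i) (x j)) →
        (Nat.card {i : Fin N // ∃ p : E3, dist p (x i) ≤ r₀ ∧ ∀ j : Fin N, r₀ ≤ dist p (x j)} : ℝ) ≤
          C * (N : ℝ) ^ (2 / 3 : ℝ) →
        ∃ p : E3, κ * (N : ℝ) ≤ (Nat.card {j : Fin N // dist (x j) p ≤ θ * (N : ℝ) ^ (1 / 3 : ℝ)} : ℝ) := by
  sorry

/-! ### The stub statements as named propositions (verbatim) -/

/-- Statement of `stub_exposedSitesCost`: the item `SurfaceTensionNoFoam.ExposedSitesCost` by name. [cite: BlancLewin2015, §2.3] -/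
def Sig.stub_exposedSitesCost : Prop := Theses.SurfaceTensionNoFoam.ExposedSitesCost

/-- Statement of `stub_surfaceExcess` (verbatim; identical to `MarginLadder.Sig.stub_surfaceExcess`). [folklore] -/
def Sig.stub_surfaceExcess : Prop :=
    ∀ P₀ : PeriodicConfiguration 3, ∃ C : ℝ, ∀ N : ℕ,
      groundStateEnergy lennardJones 3 N ≤
        (N : ℝ) * P₀.energyPerParticle lennardJones + C * (N : ℝ) ^ (2 / 3 : ℝ)

/-- Statement of `stub_concentration` (verbatim). [folklore] -/
def Sig.stub_concentration : Prop :=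
    ∀ δ r₀ : ℝ, 0 < δ → 0 < r₀ → ∀ C θ : ℝ, 0 < θ → ∃ κ : ℝ, 0 < κ ∧ ∃ N₀ : ℕ, ∀ N : ℕ, N₀ ≤ N →
      ∀ x : Fin N → E3, (∀ i j : Fin N, i ≠ j → δ ≤ dist (x i) (x j)) →
        (Nat.card {i : Fin N // ∃ p : E3, dist p (x i) ≤ r₀ ∧ ∀ j : Fin N, r₀ ≤ dist p (x j)} : ℝ) ≤
          C * (N : ℝ) ^ (2 / 3 : ℝ) →
        ∃ p : E3, κ * (N : ℝ) ≤ (Nat.card {j : Fin N // dist (x j) p ≤ θ * (N : ℝ) ^ (1 / 3 : ℝ)} : ℝ)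

/-! ### The kernel of the line, II: the three stubs give non-vanishing (sorry-free) -/

/-- **Non-vanishing from the stubs, given ONE floor-attaining periodic configuration** (`e(P₁) = e⋆`, which is what
the surface bound is compared against): `#exposed ≤ (C/c)·N^{2/3}` on ground states, then concentration at the
ground states' minimal distance. -/
theorem nonVanishing_of_floor (h₁ : Sig.stub_exposedSitesCost) (h₂ : Sig.stub_surfaceExcess)
    (h₃ : Sig.stub_concentration) {P₁ : PeriodicConfiguration 3} (hF₁ : Floor P₁) : Sig.NonVanishing := by
  intro θ hθ
  obtain ⟨r₀, hr₀, hESC⟩ := h₁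
  obtain ⟨c, hc, hcost⟩ := hESC r₀ hr₀
  obtain ⟨C, hC⟩ := h₂ P₁
  have heq : P₁.energyPerParticle lennardJones = eStar :=
    (Theorems.FluxTubeKeplerFloorGivesLayered.floor_iff_eq_eStar P₁).1 hF₁
  obtain ⟨δ, hδ, hsep⟩ := LennardJonesMinimalDistance_holds
  obtain ⟨κ, hκ, N₀, hconc⟩ := h₃ δ r₀ hδ hr₀ (C / c) θ hθ
  refine ⟨κ, hκ, ?_⟩
  filter_upwards [Filter.eventually_ge_atTop N₀] with N hN x hx
  refine hconc N hN x (hsep N x hx) ?_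
  have h1 : c * (Nat.card {i : Fin N // ∃ p : E3, dist p (x i) ≤ r₀ ∧ ∀ j : Fin N, r₀ ≤ dist p (x j)} : ℝ) ≤
      groundStateEnergy lennardJones 3 N - (N : ℝ) * eStar := hcost N x hx
  have h2 : groundStateEnergy lennardJones 3 N ≤ (N : ℝ) * eStar + C * (N : ℝ) ^ (2 / 3 : ℝ) := by
    simpa only [heq] using hC N
  rw [div_mul_eq_mul_div, le_div_iff₀ hc]
  nlinarith

/-- **Assembly.** `stub_exposedSitesCost → stub_surfaceExcess → stub_concentration → SparseBlindRung` (sorry-free):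
if some periodic configuration attains the floor, the stubs give non-vanishing and the kernel gives the rung at every
mesoscale; if none does, every `CrowdRung θ κ` holds vacuously. -/
theorem SparseBlindRung_of (h₁ : Sig.stub_exposedSitesCost) (h₂ : Sig.stub_surfaceExcess)
    (h₃ : Sig.stub_concentration) : SparseBlindRung := by
  intro θ hθ
  by_cases hex : ∃ P₁ : PeriodicConfiguration 3, Floor P₁
  · obtain ⟨P₁, hF₁⟩ := hex
    obtain ⟨κ, hκ, hev⟩ := nonVanishing_of_floor h₁ h₂ h₃ hF₁ (θ / 2) (by positivity)
    exact ⟨κ, hκ, crowdRung_of_nonVanishing hκ hev⟩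
  · exact ⟨1, one_pos, fun P₀ hF _ _ _ => (hex ⟨P₀, hF⟩).elim⟩

/-- **The closed skeleton instance**: the rung by name from the three declared stubs (the only `sorry`s of this file
enter here). [conjecture] -/
theorem SparseBlindRung_skeleton : SparseBlindRung :=
  SparseBlindRung_of stub_exposedSitesCost stub_surfaceExcess stub_concentration

/-- Registrar alias (`ledger skeleton check --crux-decl …CrowdLadder.SparseBlindRung` expects `<Decl>_proof`): the
rung by name from the three stubs; identical to `SparseBlindRung_skeleton`. [conjecture] -/
theorem SparseBlindRung_proof : SparseBlindRung := SparseBlindRung_skeleton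

end Summit.AtomisticToContinuum.Crystallization.Cruxes.FluxCellKepler.CrowdLadder

end
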